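import Summits.QuantumFields.YangMills.Theorems.EquipartitionCriticalityEquipartitionPinsProbeHaarShift
import Summits.QuantumFields.YangMills.Theorems.EquipartitionCriticalityEquipartitionPinsProbeTangentDiffIdentity
import Summits.QuantumFields.YangMills.Theorems.EquipartitionCriticalityEquipartitionPinsProbeTangentSteinPrelim
import Literature.MathematicalPhysics.QuantumFieldTheory.LatticeGaugeProofs
import Literature.MathematicalPhysics.QuantumFieldTheory.WilsonEnergyConvexity
import Mathlib.Analysis.SpecialFunctions.Exponential
import Mathlib.Analysis.Matrix.Normed
import HarnessLib

/-!
# The one-link Schwinger–Dyson (integration-by-parts) identity for Wilson's torus measure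

Crux item `stmt-QuantumFields-16192` (`CurvatureAmnesia`), line `WardDefectSketch` — groundwork for the line's engine
(card step (W-exact b)): every Schwinger–Dyson rewriting of the lattice rotation-Ward functional starts from the
exact finite-`β` integration-by-parts identity on ONE link of Wilson's measure.  For a compact group `G` with a
lattice representation `r`, a torus `(ℤ/L)^d`, a coupling `β`, an edge `e` and a multiplicative family `k : ℝ → G`:
* `integral_shiftDeriv_eq_wilson`: if `f` is continuous with a continuous derivative `f'` along the left shift
  `U ↦ U[e ↦ k(t)U_e]` at `t = 0` and `S'` is a continuous derivative of the Wilson action along it, then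
  `∫ f' dμ_β = β ∫ f S' dμ_β` — the landed finite-shift identity `haarShift_wilsonExpectation` differentiated at
  `t = 0` under the integral sign on both sides (bounded Lipschitz families on the compact configuration space);
* `exists_hasDerivAt_wilsonAction_oneLink`: for `ρ(k(t)) = exp(tX)` the action IS differentiable along the shift
  with a continuous derivative (product rule on each plaquette word); `wilson_schwingerDyson_oneLink` combines both.
References: M. Creutz, *Quarks, gluons and lattices* (1983), Ch. 11; S. Chatterjee, arXiv:1502.07719 §3.
-/

noncomputable section

open MeasureTheory Filter Topology NormedSpace
open scoped Matrix.Norms.Frobenius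
open Literature.MathematicalPhysics.QuantumFieldTheory
open Summit.QuantumFields.YangMills.Theorems.EquipartitionPinsProbe.TangentSteinFiniteBeta
  (hasDerivAt_of_flow lipschitz_of_flow abs_exp_sub_exp_le exists_abs_le_of_continuous)
open Summit.QuantumFields.YangMills.Theorems.EquipartitionPinsProbe.TangentDiffIdentity
  (hasDerivAt_integral_of_bounded_lipschitz)

namespace Summit.QuantumFields.YangMills.Cruxes.CurvatureAmnesia.WardDefect

namespace SchwingerDyson

/-! ### One-parameter families -/

section OneParam

variable {G : Type} [Group G] {k : ℝ → G}

/-- A multiplicative family `k(s+t) = k(s)k(t)` starts at `1`. [folklore] -/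
theorem oneParam_zero (hk : ∀ s t, k (s + t) = k s * k t) : k 0 = 1 := by
  have h := hk 0 0
  rw [add_zero] at h
  exact (mul_eq_left.1 h.symm)

/-- `k(-t) = k(t)⁻¹`. [folklore] -/
theorem oneParam_neg (hk : ∀ s t, k (s + t) = k s * k t) (t : ℝ) : k (-t) = (k t)⁻¹ := by
  have h := hk (-t) t
  rw [neg_add_cancel, oneParam_zero hk] at h
  exact eq_inv_of_mul_eq_one_left h.symm

/-- The one-link left shift `U ↦ U[e ↦ k(t)U_e]` is a flow: `T_{t+s} = T_t ∘ T_s`. [folklore] -/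
theorem shift_flow (hk : ∀ s t, k (s + t) = k s * k t) {d L : ℕ} (e : Edge d L) (s t : ℝ)
    (U : GaugeConfig d L G) :
    Function.update U e (k (t + s) * U e) =
      Function.update (Function.update U e (k s * U e)) e
        (k t * Function.update U e (k s * U e) e) := by
  rw [Function.update_idem, Function.update_self, ← mul_assoc, hk]

/-- `T_0 = id`. [folklore] -/
theorem shift_zero (hk : ∀ s t, k (s + t) = k s * k t) {d L : ℕ} (e : Edge d L) (U : GaugeConfig d L G) :
    Function.update U e (k 0 * U e) = U := by
  rw [oneParam_zero hk, one_mul, Function.update_eq_self]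

/-- The shift is continuous in the configuration. [folklore] -/
theorem continuous_shift [TopologicalSpace G] [IsTopologicalGroup G] {d L : ℕ} (e : Edge d L) (g : G) :
    Continuous fun U : GaugeConfig d L G => Function.update U e (g * U e) :=
  continuous_id.update e (continuous_const.mul (continuous_apply e))

end OneParam

/-! ### Matrix calculus: the shifted link factors -/

section MatrixCalculus

variable {N : ℕ}

/-- `d/dt|₀ exp(tX) = X` in `M_N(ℂ)`, real parameter. [folklore] -/
theorem hasDerivAt_exp_coe_smul (X : Matrix (Fin N) (Fin N) ℂ) :
    HasDerivAt (fun t : ℝ => exp ((t : ℂ) • X)) X 0 := by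
  have h' := hasDerivAt_exp_smul_const' (𝕂 := ℝ) X (0 : ℝ)
  have h0 : HasDerivAt (fun u : ℝ => exp ((u : ℂ) • X)) (X * exp (((0 : ℝ) : ℂ) • X)) 0 := by
    simp only [Complex.coe_smul]
    exact h'
  simpa using h0

variable {G : Type} [Group G] (ρ : G →* Matrix (Fin N) (Fin N) ℂ) {k : ℝ → G}
  {X : Matrix (Fin N) (Fin N) ℂ}

/-- A direct link factor `ρ(U[e ↦ k(t)U_e]_ℓ)`: derivative `X ρ(U_e)` if `ℓ = e`, else `0`. [folklore] -/
theorem hasDerivAt_factor (hX : ∀ t, ρ (k t) = exp ((t : ℂ) • X))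
    {d L : ℕ} (e ℓ : Edge d L) (U : GaugeConfig d L G) :
    HasDerivAt (fun t : ℝ => ρ (Function.update U e (k t * U e) ℓ))
      (if ℓ = e then X * ρ (U e) else 0) 0 := by
  by_cases h : ℓ = e
  · subst h
    simp only [Function.update_self, if_true, map_mul, hX]
    exact (hasDerivAt_exp_coe_smul X).mul_const _
  · simp only [Function.update_of_ne h, h, if_false]
    exact hasDerivAt_const _ _

/-- An inverse link factor `ρ((U[e ↦ k(t)U_e]_ℓ)⁻¹)`: derivative `ρ(U_e⁻¹)(−X)` if `ℓ = e`, else `0`. [folklore] -/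
theorem hasDerivAt_factor_inv (hk : ∀ s t, k (s + t) = k s * k t)
    (hX : ∀ t, ρ (k t) = exp ((t : ℂ) • X)) {d L : ℕ} (e ℓ : Edge d L) (U : GaugeConfig d L G) :
    HasDerivAt (fun t : ℝ => ρ ((Function.update U e (k t * U e) ℓ)⁻¹))
      (if ℓ = e then ρ ((U e)⁻¹) * (-X) else 0) 0 := by
  by_cases h : ℓ = e
  · subst h
    have hfun : (fun t : ℝ => ρ ((Function.update U ℓ (k t * U ℓ) ℓ)⁻¹)) =
        fun t : ℝ => ρ ((U ℓ)⁻¹) * exp ((t : ℂ) • (-X)) := by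
      funext t
      rw [Function.update_self, mul_inv_rev, ← oneParam_neg hk, map_mul, hX]
      congr 2
      push_cast
      rw [neg_smul, smul_neg]
    rw [hfun]
    simp only [if_true]
    exact (hasDerivAt_exp_coe_smul (-X)).const_mul _
  · simp only [Function.update_of_ne h, h, if_false]
    exact hasDerivAt_const _ _

/-- Value of a link factor at `t = 0`. [folklore] -/
theorem factor_zero (hk : ∀ s t, k (s + t) = k s * k t) {d L : ℕ} (e ℓ : Edge d L) (U : GaugeConfig d L G) :
    Function.update U e (k 0 * U e) ℓ = U ℓ := by
  rw [shift_zero hk]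

/-- `Re tr` of a differentiable matrix family is differentiable, with derivative `Re tr` of the derivative
(the real-linear functional `M ↦ Re tr M` is continuous linear). [folklore] -/
theorem hasDerivAt_reTrace {F : ℝ → Matrix (Fin N) (Fin N) ℂ} {F' : Matrix (Fin N) (Fin N) ℂ} {t : ℝ}
    (hF : HasDerivAt F F' t) : HasDerivAt (fun s => (F s).trace.re) F'.trace.re t := by
  let L : Matrix (Fin N) (Fin N) ℂ →L[ℝ] ℝ := LinearMap.toContinuousLinearMap
    (Complex.reLm.comp ((Matrix.traceLinearMap (Fin N) ℂ ℂ).restrictScalars ℝ))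
  exact L.hasFDerivAt.comp_hasDerivAt t hF

end MatrixCalculus

/-! ### The plaquette word and the Wilson action along the one-link shift -/

section Action

variable {N : ℕ} {G : Type} [Group G] (ρ : G →* Matrix (Fin N) (Fin N) ℂ) {k : ℝ → G}
  {X : Matrix (Fin N) (Fin N) ℂ}

/-- **Product rule on one plaquette word.** Along `U ↦ U[e ↦ k(t)U_e]` with `ρ(k(t)) = exp(tX)`, the matrix
`ρ(U_p)` of the plaquette at `y` in the `(i, j)` plane is differentiable at `t = 0`; its derivative is the
four-term Leibniz sum (the shifted link enters the word as `exp(tX)ρ(U_e)` in a direct slot and as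
`ρ(U_e⁻¹)exp(−tX)` in an inverse slot). [folklore] -/
theorem hasDerivAt_rho_holonomy (hk : ∀ s t, k (s + t) = k s * k t) (hX : ∀ t, ρ (k t) = exp ((t : ℂ) • X))
    {d L : ℕ} (e : Edge d L) (U : GaugeConfig d L G) (y : Site d L) (i j : Fin d) :
    HasDerivAt (fun t : ℝ => ρ (plaquetteHolonomy (Function.update U e (k t * U e)) y i j))
      ((((if (y, i) = e then X * ρ (U e) else 0) * ρ (U (y.shift i, j)) +
            ρ (U (y, i)) * (if (y.shift i, j) = e then X * ρ (U e) else 0)) * ρ ((U (y.shift j, i))⁻¹) +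
          ρ (U (y, i)) * ρ (U (y.shift i, j)) *
            (if (y.shift j, i) = e then ρ ((U e)⁻¹) * (-X) else 0)) * ρ ((U (y, j))⁻¹) +
        ρ (U (y, i)) * ρ (U (y.shift i, j)) * ρ ((U (y.shift j, i))⁻¹) *
          (if (y, j) = e then ρ ((U e)⁻¹) * (-X) else 0)) 0 := by
  have h1 := hasDerivAt_factor ρ hX e (y, i) U
  have h2 := hasDerivAt_factor ρ hX e (y.shift i, j) U
  have h3 := hasDerivAt_factor_inv ρ hk hX e (y.shift j, i) U
  have h4 := hasDerivAt_factor_inv ρ hk hX e (y, j) U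
  have h := ((h1.mul h2).mul h3).mul h4
  have hz : ∀ ℓ : Edge d L, Function.update U e (k 0 * U e) ℓ = U ℓ := fun ℓ => factor_zero hk e ℓ U
  simp only [Pi.mul_apply, hz] at h
  have hfun : ∀ t : ℝ, ρ (plaquetteHolonomy (Function.update U e (k t * U e)) y i j) =
      ((((fun t : ℝ => ρ (Function.update U e (k t * U e) (y, i))) * fun t : ℝ =>
          ρ (Function.update U e (k t * U e) (y.shift i, j))) *
        fun t : ℝ => ρ (Function.update U e (k t * U e) (y.shift j, i))⁻¹) *
      fun t : ℝ => ρ (Function.update U e (k t * U e) (y, j))⁻¹) t := by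
    intro t
    simp only [Pi.mul_apply, plaquetteHolonomy, map_mul]
  exact h.congr_of_eventuallyEq (Eventually.of_forall hfun)

variable [TopologicalSpace G] [IsTopologicalGroup G]

omit [IsTopologicalGroup G] in
/-- Continuity in `U` of a direct-slot derivative factor. [folklore] -/
theorem continuous_slotDeriv (hρ : Continuous ρ) {d L : ℕ} (c : Prop) [Decidable c] (e : Edge d L)
    (Y : Matrix (Fin N) (Fin N) ℂ) :
    Continuous fun U : GaugeConfig d L G => (if c then Y * ρ (U e) else 0 : Matrix (Fin N) (Fin N) ℂ) := by
  split_ifs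
  · exact continuous_const.mul (hρ.comp (continuous_apply e))
  · exact continuous_const

/-- Continuity in `U` of an inverse-slot derivative factor. [folklore] -/
theorem continuous_slotDeriv_inv (hρ : Continuous ρ) {d L : ℕ} (c : Prop) [Decidable c] (e : Edge d L)
    (Y : Matrix (Fin N) (Fin N) ℂ) :
    Continuous fun U : GaugeConfig d L G => (if c then ρ ((U e)⁻¹) * Y else 0 : Matrix (Fin N) (Fin N) ℂ) := by
  split_ifs
  · exact (hρ.comp ((continuous_apply e).inv)).mul continuous_const
  · exact continuous_const

/-- Continuity in `U` of the Leibniz sum of one plaquette word. [folklore] -/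
theorem continuous_leibniz (hρ : Continuous ρ) {d L : ℕ} (e : Edge d L) (y : Site d L) (i j : Fin d) :
    Continuous fun U : GaugeConfig d L G =>
      (((if (y, i) = e then X * ρ (U e) else 0) * ρ (U (y.shift i, j)) +
            ρ (U (y, i)) * (if (y.shift i, j) = e then X * ρ (U e) else 0)) * ρ ((U (y.shift j, i))⁻¹) +
          ρ (U (y, i)) * ρ (U (y.shift i, j)) *
            (if (y.shift j, i) = e then ρ ((U e)⁻¹) * (-X) else 0)) * ρ ((U (y, j))⁻¹) +
        ρ (U (y, i)) * ρ (U (y.shift i, j)) * ρ ((U (y.shift j, i))⁻¹) *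
          (if (y, j) = e then ρ ((U e)⁻¹) * (-X) else 0) := by
  have hd : ∀ ℓ : Edge d L, Continuous fun U : GaugeConfig d L G => ρ (U ℓ) :=
    fun ℓ => hρ.comp (continuous_apply ℓ)
  have hi : ∀ ℓ : Edge d L, Continuous fun U : GaugeConfig d L G => ρ ((U ℓ)⁻¹) :=
    fun ℓ => hρ.comp ((continuous_apply ℓ).inv)
  have s1 := continuous_slotDeriv ρ hρ ((y, i) = e) e X
  have s2 := continuous_slotDeriv ρ hρ ((y.shift i, j) = e) e X
  have s3 := continuous_slotDeriv_inv ρ hρ ((y.shift j, i) = e) e (-X)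
  have s4 := continuous_slotDeriv_inv ρ hρ ((y, j) = e) e (-X)
  exact ((((s1.mul (hd _)).add ((hd _).mul s2)).mul (hi _)).add (((hd _).mul (hd _)).mul s3)).mul (hi _)
    |>.add ((((hd _).mul (hd _)).mul (hi _)).mul s4)

/-- **The Wilson action is differentiable along the one-link shift, with a continuous derivative** (any compact
`G`, any continuous representation `ρ`, any torus, any exponential one-parameter family): `S'(U)` is the sum over
plaquettes of `−Re tr` of the Leibniz sums. [folklore] -/
theorem exists_hasDerivAt_wilsonAction_oneLink (hρ : Continuous ρ) (hk : ∀ s t, k (s + t) = k s * k t)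
    (hX : ∀ t, ρ (k t) = exp ((t : ℂ) • X)) {d L : ℕ} [NeZero L] (e : Edge d L) :
    ∃ S' : GaugeConfig d L G → ℝ, Continuous S' ∧
      ∀ U : GaugeConfig d L G,
        HasDerivAt (fun t : ℝ => wilsonAction (d := d) (L := L) ρ (Function.update U e (k t * U e))) (S' U) 0 := by
  refine ⟨fun U => ∑ p : Plaquette d L,
      -((((if (p.1, p.2.1.1) = e then X * ρ (U e) else 0) * ρ (U (p.1.shift p.2.1.1, p.2.1.2)) +
            ρ (U (p.1, p.2.1.1)) * (if (p.1.shift p.2.1.1, p.2.1.2) = e then X * ρ (U e) else 0)) *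
              ρ ((U (p.1.shift p.2.1.2, p.2.1.1))⁻¹) +
          ρ (U (p.1, p.2.1.1)) * ρ (U (p.1.shift p.2.1.1, p.2.1.2)) *
            (if (p.1.shift p.2.1.2, p.2.1.1) = e then ρ ((U e)⁻¹) * (-X) else 0)) * ρ ((U (p.1, p.2.1.2))⁻¹) +
        ρ (U (p.1, p.2.1.1)) * ρ (U (p.1.shift p.2.1.1, p.2.1.2)) * ρ ((U (p.1.shift p.2.1.2, p.2.1.1))⁻¹) *
          (if (p.1, p.2.1.2) = e then ρ ((U e)⁻¹) * (-X) else 0)).trace.re, ?_, fun U => ?_⟩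
  · refine continuous_finsetSum _ fun p _ => ?_
    exact (Complex.continuous_re.comp (continuous_leibniz ρ hρ e p.1 p.2.1.1 p.2.1.2).matrix_trace).neg
  · unfold wilsonAction
    exact HasDerivAt.fun_sum fun p _ =>
      (hasDerivAt_reTrace (hasDerivAt_rho_holonomy ρ hk hX e U p.1 p.2.1.1 p.2.1.2)).const_sub (N : ℝ)

/-- **A single plaquette function** `Re tr ρ(U_p)` (the building block of cylinder observables such as the action
density) is differentiable along the one-link shift with a continuous derivative. [folklore] -/
theorem exists_hasDerivAt_reTrace_holonomy_oneLink (hρ : Continuous ρ) (hk : ∀ s t, k (s + t) = k s * k t)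
    (hX : ∀ t, ρ (k t) = exp ((t : ℂ) • X)) {d L : ℕ} (e : Edge d L) (y : Site d L) (i j : Fin d) :
    ∃ f' : GaugeConfig d L G → ℝ, Continuous f' ∧
      ∀ U : GaugeConfig d L G,
        HasDerivAt (fun t : ℝ => (ρ (plaquetteHolonomy (Function.update U e (k t * U e)) y i j)).trace.re)
          (f' U) 0 :=
  ⟨_, Complex.continuous_re.comp (continuous_leibniz (X := X) ρ hρ e y i j).matrix_trace,
    fun U => hasDerivAt_reTrace (hasDerivAt_rho_holonomy ρ hk hX e U y i j)⟩

end Action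

/-! ### The Schwinger–Dyson identity -/

section Identity

variable {G : Type} [Group G] [TopologicalSpace G] [IsTopologicalGroup G] [CompactSpace G]
  [MeasurableSpace G] [BorelSpace G]

/-- **One-link Schwinger–Dyson (integration-by-parts) identity for Wilson's torus measure.**  For a compact group
`G` with a lattice representation `r`, the torus `(ℤ/L)^d`, a coupling `β`, an edge `e` and a multiplicative family
`k : ℝ → G` (`k(s+t) = k(s)k(t)`): if the real observable `f` is continuous with a continuous derivative `f'` along
the left shift `U ↦ U[e ↦ k(t)U_e]` at `t = 0`, and `S'` is a continuous derivative of the Wilson action along the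
same shift, then `∫ f' dμ_β = β ∫ f S' dμ_β` (`μ_β` = `wilsonMeasure r.ρ β`).  Proof: differentiate the finite-shift
identity `haarShift_wilsonExpectation` at `t = 0` under the integral sign on both sides. [folklore] -/
theorem integral_shiftDeriv_eq_wilson (r : LatticeRep G) {d L : ℕ} [NeZero L] (β : ℝ) (e : Edge d L)
    {k : ℝ → G} (hk : ∀ s t, k (s + t) = k s * k t)
    (f f' : GaugeConfig d L G → ℝ) (hf : Continuous f) (hf'c : Continuous f')
    (hf' : ∀ U, HasDerivAt (fun t => f (Function.update U e (k t * U e))) (f' U) 0)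
    (S' : GaugeConfig d L G → ℝ) (hS'c : Continuous S')
    (hS' : ∀ U, HasDerivAt (fun t => wilsonAction (d := d) (L := L) r.ρ (Function.update U e (k t * U e)))
      (S' U) 0) :
    ∫ U, f' U ∂(wilsonMeasure (d := d) (L := L) r.ρ β) =
      β * ∫ U, f U * S' U ∂(wilsonMeasure (d := d) (L := L) r.ρ β) := by
  -- a faithful matrix representation makes `G` second countable, so continuous functions on the (compact)
  -- configuration space are measurable for the product σ-algebra
  haveI : SecondCountableTopology G :=
    (r.continuous.isClosedEmbedding r.injective).isEmbedding.secondCountableTopology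
  haveI := isProbabilityMeasure_wilsonMeasure (d := d) (L := L) r.ρ r.continuous β
  set μ := wilsonMeasure (d := d) (L := L) r.ρ β with hμ
  set S := wilsonAction (d := d) (L := L) r.ρ with hSdef
  set T : ℝ → GaugeConfig d L G → GaugeConfig d L G := fun t U => Function.update U e (k t * U e) with hT
  have hflow : ∀ s t U, T (t + s) U = T t (T s U) := fun s t U => shift_flow hk e s t U
  have hT0 : ∀ U, T 0 U = U := fun U => shift_zero hk e U
  have hTc : ∀ t, Continuous (T t) := fun t => continuous_shift e (k t)
  have hf'T : ∀ U, HasDerivAt (fun t => f (T t U)) (f' U) 0 := hf'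
  have hS'T : ∀ U, HasDerivAt (fun t => S (T t U)) (S' U) 0 := hS'
  -- bounds by compactness
  obtain ⟨Cf, hCf0, hCf⟩ := exists_abs_le_of_continuous hf
  obtain ⟨Cf', -, hCf'⟩ := exists_abs_le_of_continuous hf'c
  obtain ⟨CS', hCS'0, hCS'⟩ := exists_abs_le_of_continuous hS'c
  have hSc : Continuous S := continuous_wilsonAction_of_continuous (d := d) (L := L) r.ρ r.continuous
  obtain ⟨CS, -, hCS⟩ := exists_abs_le_of_continuous hSc
  -- the two sides of the finite-shift identity, as functions of `t`
  have hAB : ∀ t : ℝ, ∫ U, f (T t U) ∂μ = ∫ U, f U * Real.exp (-(β * (S (T (-t) U) - S U))) ∂μ := by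
    intro t
    have h := Summit.QuantumFields.YangMills.Theorems.EquipartitionPinsProbe.haarShift_wilsonExpectation G r.ρ
      r.continuous d L β e (k t) f
    rw [← oneParam_neg hk t] at h
    exact h
  -- derivative of the left side
  have hAd : HasDerivAt (fun t : ℝ => ∫ U, f (T t U) ∂μ) (∫ U, f' U ∂μ) 0 := by
    refine hasDerivAt_integral_of_bounded_lipschitz μ (fun t U => f (T t U)) f' (Cf + Cf')
      (fun t => (hf.comp (hTc t)).measurable) hf'c.measurable
      (fun t U => (hCf _).trans (le_add_of_nonneg_right ?_)) (fun U t s => ?_) hf'T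
    · exact (abs_nonneg _).trans (hCf' U)
    · calc |f (T t U) - f (T s U)| ≤ Cf' * |t - s| := lipschitz_of_flow T hflow f f' hf'T hCf' U t s
        _ ≤ (Cf + Cf') * |t - s| := by gcongr; linarith [(abs_nonneg _).trans (hCf U)]
  -- derivative of the right side
  have hBd : HasDerivAt (fun t : ℝ => ∫ U, f U * Real.exp (-(β * (S (T (-t) U) - S U))) ∂μ)
      (∫ U, f U * (β * S' U) ∂μ) 0 := by
    set M := |β| * (2 * CS) with hMdef
    have hM : ∀ t U, -(β * (S (T (-t) U) - S U)) ≤ M := fun t U => by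
      have h1 := hCS (T (-t) U)
      have h2 := hCS U
      calc -(β * (S (T (-t) U) - S U)) ≤ |β * (S (T (-t) U) - S U)| := neg_le_abs _
        _ = |β| * |S (T (-t) U) - S U| := abs_mul _ _
        _ ≤ |β| * (2 * CS) := by
            gcongr
            calc |S (T (-t) U) - S U| ≤ |S (T (-t) U)| + |S U| := abs_sub _ _
              _ ≤ CS + CS := add_le_add h1 h2
              _ = 2 * CS := by ring
    have hE : ∀ t U, |Real.exp (-(β * (S (T (-t) U) - S U)))| ≤ Real.exp M := fun t U => by
      rw [abs_of_pos (Real.exp_pos _)]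
      exact Real.exp_le_exp.2 (hM t U)
    have hSlip : ∀ U t s, |S (T (-t) U) - S (T (-s) U)| ≤ CS' * |t - s| := fun U t s => by
      have h := lipschitz_of_flow T hflow S S' hS'T hCS' U (-t) (-s)
      rwa [show |(-t) - (-s)| = |t - s| by rw [neg_sub_neg, abs_sub_comm]] at h
    refine hasDerivAt_integral_of_bounded_lipschitz μ
      (fun t U => f U * Real.exp (-(β * (S (T (-t) U) - S U)))) (fun U => f U * (β * S' U))
      (Cf * Real.exp M + Cf * (Real.exp M * (|β| * CS'))) (fun t => ?_) ?_ (fun t U => ?_)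
      (fun U t s => ?_) (fun U => ?_)
    · exact (hf.mul (Real.continuous_exp.comp
        (((hSc.comp (hTc (-t))).sub hSc).const_mul β).neg)).measurable
    · exact (hf.mul (hS'c.const_mul β)).measurable
    · calc |f U * Real.exp (-(β * (S (T (-t) U) - S U)))|
          = |f U| * |Real.exp (-(β * (S (T (-t) U) - S U)))| := abs_mul _ _
        _ ≤ Cf * Real.exp M := mul_le_mul (hCf U) (hE t U) (abs_nonneg _) hCf0
        _ ≤ Cf * Real.exp M + Cf * (Real.exp M * (|β| * CS')) := le_add_of_nonneg_right (by positivity)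
    · have hx : -(β * (S (T (-t) U) - S U)) ≤ M := hM t U
      have hy : -(β * (S (T (-s) U) - S U)) ≤ M := hM s U
      calc |f U * Real.exp (-(β * (S (T (-t) U) - S U))) - f U * Real.exp (-(β * (S (T (-s) U) - S U)))|
          = |f U| * |Real.exp (-(β * (S (T (-t) U) - S U))) - Real.exp (-(β * (S (T (-s) U) - S U)))| := by
            rw [← mul_sub, abs_mul]
        _ ≤ Cf * (Real.exp M * |(-(β * (S (T (-t) U) - S U))) - (-(β * (S (T (-s) U) - S U)))|) :=
            mul_le_mul (hCf U) (abs_exp_sub_exp_le hx hy) (abs_nonneg _) hCf0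
        _ = Cf * (Real.exp M * (|β| * |S (T (-t) U) - S (T (-s) U)|)) := by
            rw [show -(β * (S (T (-t) U) - S U)) - -(β * (S (T (-s) U) - S U)) =
              -(β * (S (T (-t) U) - S (T (-s) U))) by ring, abs_neg, abs_mul]
        _ ≤ Cf * (Real.exp M * (|β| * (CS' * |t - s|))) := by gcongr; exact hSlip U t s
        _ = Cf * (Real.exp M * (|β| * CS')) * |t - s| := by ring
        _ ≤ (Cf * Real.exp M + Cf * (Real.exp M * (|β| * CS'))) * |t - s| := by
            have : 0 ≤ Cf * Real.exp M * |t - s| := by positivity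
            nlinarith [this]
    · have hSneg : HasDerivAt (fun t : ℝ => S (T (-t) U)) (-(S' U)) 0 := by
        have h0 : HasDerivAt (fun t : ℝ => S (T t U)) (S' U) (-0) := by rw [neg_zero]; exact hS'T U
        have h := h0.scomp (0 : ℝ) (hasDerivAt_neg (0 : ℝ))
        simpa [Function.comp_def] using h
      have hin : HasDerivAt (fun t : ℝ => -(β * (S (T (-t) U) - S U))) (β * S' U) 0 := by
        exact (((hSneg.sub_const (S U)).const_mul β).neg).congr_deriv (by ring)
      have hexp := hin.exp
      have h0 : -(β * (S (T (-0) U) - S U)) = 0 := by rw [neg_zero, hT0, sub_self, mul_zero, neg_zero]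
      rw [h0, Real.exp_zero, one_mul] at hexp
      exact hexp.const_mul (f U)
  -- the two sides agree, hence so do their derivatives
  have hEq : (fun t : ℝ => ∫ U, f (T t U) ∂μ) =
      fun t : ℝ => ∫ U, f U * Real.exp (-(β * (S (T (-t) U) - S U))) ∂μ := funext hAB
  rw [hEq] at hAd
  rw [hAd.unique hBd, ← integral_const_mul]
  refine integral_congr_ae (ae_of_all _ fun U => ?_)
  ring

/-- **Schwinger–Dyson identity, exponential family** (the form used in practice; closed statement registered as a
sub-goal of crux item stmt-QuantumFields-16192): for `ρ(k(t)) = exp(tX)` the Wilson action IS differentiable along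
the shift with a continuous derivative `S'` (`exists_hasDerivAt_wilsonAction_oneLink`), so for every continuous
observable `f` with a continuous shift-derivative `f'` there is such an `S'` with `∫ f' dμ_β = β ∫ f S' dμ_β`. [folklore] -/
theorem wilson_schwingerDyson_oneLink : ∀ (G : Type) [Group G] [TopologicalSpace G] [IsTopologicalGroup G] [CompactSpace G] [MeasurableSpace G] [BorelSpace G] (r : LatticeRep G) (d L : ℕ) [NeZero L] (β : ℝ) (e : Edge d L) (k : ℝ → G), (∀ s t : ℝ, k (s + t) = k s * k t) → ∀ (X : Matrix (Fin r.N) (Fin r.N) ℂ), (∀ t : ℝ, r.ρ (k t) = NormedSpace.exp ((t : ℂ) • X)) → ∀ (f f' : GaugeConfig d L G → ℝ), Continuous f → Continuous f' → (∀ U : GaugeConfig d L G, HasDerivAt (fun t : ℝ => f (Function.update U e (k t * U e))) (f' U) 0) → ∃ S' : GaugeConfig d L G → ℝ, Continuous S' ∧ (∀ U : GaugeConfig d L G, HasDerivAt (fun t : ℝ => wilsonAction (d := d) (L := L) r.ρ (Function.update U e (k t * U e))) (S' U) 0) ∧ ∫ U, f' U ∂(wilsonMeasure (d := d) (L := L)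 r.ρ β) = β * ∫ U, f U * S' U ∂(wilsonMeasure (d := d) (L := L) r.ρ β) := by
  intro G _ _ _ _ _ _ r d L _ β e k hk X hX f f' hf hf'c hf'
  obtain ⟨S', hS'c, hS'⟩ := exists_hasDerivAt_wilsonAction_oneLink r.ρ r.continuous hk hX (d := d) (L := L) e
  exact ⟨S', hS'c, hS', integral_shiftDeriv_eq_wilson r β e hk f f' hf hf'c hf' S' hS'c hS'⟩

end Identity

end SchwingerDyson

end Summit.QuantumFields.YangMills.Cruxes.CurvatureAmnesia.WardDefect

end
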